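import Mathlib.Analysis.Complex.Liouville
import Mathlib.Analysis.Complex.CauchyIntegral
import Mathlib.Topology.MetricSpace.Contracting
import Mathlib.Topology.UniformSpace.HeineCantor
import Mathlib.Analysis.Calculus.MeanValue
import HarnessLib

/-!
# Persistence of a simple zero of a holomorphic function under a continuous perturbation
# (Newton contraction with Cauchy estimates)

Topic `Literature/Analysis/Complex` (namespace `Literature.Analysis.Complex`). Let `F(ω, μ)` be
holomorphic in `ω ∈ B(ω₀, ρ₁)` for each real `μ` near `μ₀`, jointly continuous, with a **simple
zero** at `(ω₀, μ₀)`: `F(ω₀, μ₀) = 0`, `c = ∂_ω F(ω₀, μ₀) ≠ 0`. Then for every accuracy `θ ∈ (0, 1]`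
and every radius `ρ` there are `ρ' ≤ ρ` and `δ > 0` such that for `|μ − μ₀| < δ` the function
`F(·, μ)` has a zero `ω(μ)` in the closed disc `B̄(ω₀, ρ')` with

  `‖ω(μ) − (ω₀ − F(ω₀, μ)/c)‖ ≤ θ ‖F(ω₀, μ)/c‖`

(`exists_zero_near_simple_zero`): the Newton map `N(ω) = ω − F(ω, μ)/c` is a contraction of the
disc (its derivative `1 − ∂_ωF/c` is small by continuity of `∂_ωF(·, μ₀)` and the **Cauchy estimate**
for `∂_ω(F(·, μ) − F(·, μ₀))`, `Complex.norm_deriv_le_of_forall_mem_sphere_norm_le`), and the a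
priori bound of the contraction principle locates the fixed point to first order. This is the
one-complex-variable substitute for the implicit function theorem used in
Shlapentokh-Rothman, CMP 329 (2014), §4.3 (perturbing a real mode into `Im ω > 0`), requiring only
continuity — no differentiability — in the real parameter `μ`. Theorems only; everything proved.

## References
* L. V. Ahlfors, *Complex Analysis*, 3rd ed., McGraw–Hill 1979, Ch. 4 §3.3 (Cauchy's estimate) and
  Ch. 5 §1 (Hurwitz); the contraction form is folklore.
* Y. Shlapentokh-Rothman, Comm. Math. Phys. 329 (2014) 859–891, §4.3. Key `ShlapentokhRothman2014KleinGordon`.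
-/

noncomputable section

open Set Metric Filter Function
open scoped Topology NNReal

namespace Literature.Analysis.Complex

/-- **Cauchy estimate for a difference**: if `g` is differentiable on an open set containing the
closed disc `B̄(ω, r)` and `‖g‖ ≤ ε` on the circle `|z − ω| = r`, then `‖g'(ω)‖ ≤ ε/r`.
[cite: Ahlfors1979, Ch. 4 §3.3] -/
theorem norm_deriv_le_of_sphere {g : ℂ → ℂ} {U : Set ℂ} (hg : DifferentiableOn ℂ g U)
    {ω : ℂ} {r ε : ℝ} (hr : 0 < r) (hsub : closedBall ω r ⊆ U) (hε : ∀ z ∈ sphere ω r, ‖g z‖ ≤ ε) :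
    ‖deriv g ω‖ ≤ ε / r := by
  have hd : DiffContOnCl ℂ g (ball ω r) := by
    refine DifferentiableOn.diffContOnCl ?_
    rw [closure_ball ω hr.ne']
    exact hg.mono hsub
  exact Complex.norm_deriv_le_of_forall_mem_sphere_norm_le hr hd hε

/-- A fixed point of a `q`-contraction, located to first order from the first iterate:
`(1 − q) ‖y − N x‖ ≤ q ‖N x − x‖`. [folklore] -/
theorem norm_fixedPt_sub_le {N : ℂ → ℂ} {s : Set ℂ} {q : ℝ} (hq : 0 ≤ q)
    (hN : ∀ x ∈ s, ∀ y ∈ s, ‖N x - N y‖ ≤ q * ‖x - y‖)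
    {x y : ℂ} (hx : x ∈ s) (hy : y ∈ s) (hfix : N y = y) :
    (1 - q) * ‖y - N x‖ ≤ q * ‖N x - x‖ := by
  have h1 : ‖y - N x‖ = ‖N y - N x‖ := by rw [hfix]
  have h2 : ‖N y - N x‖ ≤ q * ‖y - x‖ := hN y hy x hx
  have h3 : ‖y - x‖ ≤ ‖y - N x‖ + ‖N x - x‖ := norm_sub_le_norm_sub_add_norm_sub _ _ _
  nlinarith [mul_le_mul_of_nonneg_left h3 hq]

/-- **A contraction of a closed disc into itself has a fixed point** (Banach). [folklore] -/
theorem exists_fixedPt_of_contraction {N : ℂ → ℂ} {ω₀ : ℂ} {ρ q : ℝ} (hq0 : 0 ≤ q) (hq1 : q < 1)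
    (hmaps : MapsTo N (closedBall ω₀ ρ) (closedBall ω₀ ρ))
    (hN : ∀ x ∈ closedBall ω₀ ρ, ∀ y ∈ closedBall ω₀ ρ, ‖N x - N y‖ ≤ q * ‖x - y‖) (hρ : 0 ≤ ρ) :
    ∃ y ∈ closedBall ω₀ ρ, N y = y := by
  set K : ℝ≥0 := ⟨q, hq0⟩ with hK
  have hcw : ContractingWith K (hmaps.restrict N (closedBall ω₀ ρ) (closedBall ω₀ ρ)) := by
    refine ⟨by exact_mod_cast hq1, LipschitzWith.of_dist_le_mul fun x y ↦ ?_⟩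
    simp only [MapsTo.val_restrict_apply, Subtype.dist_eq, dist_eq_norm, hK]
    exact hN x x.2 y y.2
  obtain ⟨y, hy, hfix, -⟩ := ContractingWith.exists_fixedPoint' (isClosed_closedBall.isComplete) hmaps hcw
    (mem_closedBall_self hρ) (edist_ne_top _ _)
  exact ⟨y, hy, hfix⟩

/-- **Persistence of a simple zero.** See the module docstring.
[cite: ShlapentokhRothman2014KleinGordon, §4.3; Ahlfors1979, Ch. 4 §3.3] -/
theorem exists_zero_near_simple_zero {F : ℂ → ℝ → ℂ} {ω₀ : ℂ} {μ₀ ρ₁ δ₀ : ℝ} (hρ₁ : 0 < ρ₁) (hδ₀ : 0 < δ₀)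
    (hhol : ∀ μ ∈ Icc (μ₀ - δ₀) (μ₀ + δ₀), DifferentiableOn ℂ (fun ω ↦ F ω μ) (ball ω₀ ρ₁))
    (hcont : ContinuousOn (fun q : ℂ × ℝ ↦ F q.1 q.2) (ball ω₀ ρ₁ ×ˢ Icc (μ₀ - δ₀) (μ₀ + δ₀)))
    (h0 : F ω₀ μ₀ = 0) (hc : deriv (fun ω ↦ F ω μ₀) ω₀ ≠ 0) {θ : ℝ} (hθ : 0 < θ) (hθ1 : θ ≤ 1)
    {ρ : ℝ} (hρ : 0 < ρ) :
    ∃ ρ' ∈ Ioc 0 ρ, ∃ δ > 0, ∀ μ : ℝ, |μ - μ₀| < δ → ∃ ω ∈ closedBall ω₀ ρ', F ω μ = 0 ∧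
      ‖ω - (ω₀ - F ω₀ μ / deriv (fun ω ↦ F ω μ₀) ω₀)‖ ≤ θ * ‖F ω₀ μ / deriv (fun ω ↦ F ω μ₀) ω₀‖ := by
  set c : ℂ := deriv (fun ω ↦ F ω μ₀) ω₀ with hc_def
  have hcn : 0 < ‖c‖ := norm_pos_iff.2 hc
  set q : ℝ := θ / 2 with hq
  have hq0 : 0 < q := by positivity
  have hq1 : q ≤ 1 / 2 := by rw [hq]; linarith
  have hμ₀ : μ₀ ∈ Icc (μ₀ - δ₀) (μ₀ + δ₀) := ⟨by linarith, by linarith⟩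
  -- (1) continuity of `∂_ω F(·, μ₀)` at `ω₀`
  have hF₀ := hhol μ₀ hμ₀
  have hderc : ContinuousOn (deriv fun ω ↦ F ω μ₀) (ball ω₀ ρ₁) :=
    (hF₀.contDiffOn isOpen_ball (n := 1)).continuousOn_deriv_of_isOpen isOpen_ball le_rfl
  have hderat : ContinuousAt (deriv fun ω ↦ F ω μ₀) ω₀ := hderc.continuousAt (ball_mem_nhds ω₀ hρ₁)
  obtain ⟨ρ₂, hρ₂, hρ₂'⟩ := Metric.continuousAt_iff.1 hderat (q * ‖c‖ / 2) (by positivity)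
  -- the working radius
  set ρ' : ℝ := min (min ρ (ρ₁ / 4)) (ρ₂ / 2) with hρ'
  have hρ'0 : 0 < ρ' := lt_min (lt_min hρ (by positivity)) (by positivity)
  have hρ'ρ : ρ' ≤ ρ := (min_le_left _ _).trans (min_le_left _ _)
  have hρ'1 : 4 * ρ' ≤ ρ₁ := by
    have := (min_le_left (min ρ (ρ₁ / 4)) (ρ₂ / 2)).trans (min_le_right ρ (ρ₁ / 4)); linarith
  have hρ'2 : 2 * ρ' ≤ ρ₂ := by have := min_le_right (min ρ (ρ₁ / 4)) (ρ₂ / 2); linarith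
  have hder₀ : ∀ ω ∈ closedBall ω₀ ρ', ‖deriv (fun ω ↦ F ω μ₀) ω - c‖ < q * ‖c‖ / 2 := by
    intro ω hω
    have hd : dist ω ω₀ < ρ₂ := lt_of_le_of_lt (mem_closedBall.1 hω) (by linarith)
    have := hρ₂' hd
    rwa [dist_eq_norm] at this
  -- (2) uniform continuity of `F` on the compact `B̄(ω₀, 2ρ') × [μ₀ − δ₀, μ₀ + δ₀]`
  set Kc : Set (ℂ × ℝ) := closedBall ω₀ (2 * ρ') ×ˢ Icc (μ₀ - δ₀) (μ₀ + δ₀) with hKc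
  have hKsub : Kc ⊆ ball ω₀ ρ₁ ×ˢ Icc (μ₀ - δ₀) (μ₀ + δ₀) :=
    prod_mono (closedBall_subset_ball (by linarith)) Subset.rfl
  have hKcpt : IsCompact Kc := (isCompact_closedBall _ _).prod isCompact_Icc
  have hUC := hKcpt.uniformContinuousOn_of_continuous (hcont.mono hKsub)
  set ε : ℝ := q * ‖c‖ * ρ' / 2 with hε
  have hε0 : 0 < ε := by positivity
  obtain ⟨δ₁, hδ₁, hδ₁'⟩ := Metric.uniformContinuousOn_iff.1 hUC ε hε0
  set δ : ℝ := min δ₁ δ₀ with hδ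
  have hδp : 0 < δ := lt_min hδ₁ hδ₀
  refine ⟨ρ', ⟨hρ'0, hρ'ρ⟩, δ, hδp, fun μ hμ ↦ ?_⟩
  have hμ₁ : |μ - μ₀| < δ₁ := lt_of_lt_of_le hμ (min_le_left _ _)
  have hμI : μ ∈ Icc (μ₀ - δ₀) (μ₀ + δ₀) := by
    have := lt_of_lt_of_le hμ (min_le_right _ _)
    exact ⟨by linarith [(abs_lt.1 this).1], by linarith [(abs_lt.1 this).2]⟩
  have hFμ := hhol μ hμI
  -- (3) `‖F(z, μ) − F(z, μ₀)‖ < ε` on `B̄(ω₀, 2ρ')`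
  have hdiff : ∀ z ∈ closedBall ω₀ (2 * ρ'), ‖F z μ - F z μ₀‖ < ε := by
    intro z hz
    have h1 := hδ₁' (z, μ) ⟨hz, hμI⟩ (z, μ₀) ⟨hz, hμ₀⟩ (by
      rw [Prod.dist_eq, dist_self, Real.dist_eq]
      exact max_lt_iff.2 ⟨hδ₁, hμ₁⟩)
    rwa [dist_eq_norm] at h1
  -- (4) derivative control on `B̄(ω₀, ρ')`
  have hballsub : ∀ ω ∈ closedBall ω₀ ρ', closedBall ω ρ' ⊆ closedBall ω₀ (2 * ρ') := by
    intro ω hω z hz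
    rw [mem_closedBall] at hω hz ⊢
    calc dist z ω₀ ≤ dist z ω + dist ω ω₀ := dist_triangle _ _ _
      _ ≤ ρ' + ρ' := add_le_add hz hω
      _ = 2 * ρ' := by ring
  have hcb : closedBall ω₀ (2 * ρ') ⊆ ball ω₀ ρ₁ := closedBall_subset_ball (by linarith)
  have hderμ : ∀ ω ∈ closedBall ω₀ ρ', ‖deriv (fun ω ↦ F ω μ) ω - c‖ ≤ q * ‖c‖ := by
    intro ω hω
    set g : ℂ → ℂ := fun z ↦ F z μ - F z μ₀ with hg
    have hgd : DifferentiableOn ℂ g (ball ω₀ ρ₁) := hFμ.sub hF₀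
    have hsub : closedBall ω ρ' ⊆ ball ω₀ ρ₁ := (hballsub ω hω).trans hcb
    have hgb := norm_deriv_le_of_sphere hgd hρ'0 hsub fun z hz ↦
      (hdiff z (hballsub ω hω (sphere_subset_closedBall hz))).le
    have hωb : ω ∈ ball ω₀ ρ₁ := hcb (hballsub ω hω (mem_closedBall_self hρ'0.le))
    have hdg : deriv g ω = deriv (fun z ↦ F z μ) ω - deriv (fun z ↦ F z μ₀) ω := by
      rw [hg]
      exact deriv_sub (hFμ.differentiableAt (isOpen_ball.mem_nhds hωb))
        (hF₀.differentiableAt (isOpen_ball.mem_nhds hωb))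
    have h1 : ‖deriv (fun z ↦ F z μ) ω - deriv (fun z ↦ F z μ₀) ω‖ ≤ ε / ρ' := by rw [← hdg]; exact hgb
    have h2 : ε / ρ' = q * ‖c‖ / 2 := by rw [hε]; field_simp
    have h3 := hder₀ ω hω
    calc ‖deriv (fun ω ↦ F ω μ) ω - c‖ = ‖(deriv (fun z ↦ F z μ) ω - deriv (fun z ↦ F z μ₀) ω) +
          (deriv (fun z ↦ F z μ₀) ω - c)‖ := by ring_nf
      _ ≤ ‖deriv (fun z ↦ F z μ) ω - deriv (fun z ↦ F z μ₀) ω‖ + ‖deriv (fun z ↦ F z μ₀) ω - c‖ := norm_add_le _ _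
      _ ≤ q * ‖c‖ / 2 + q * ‖c‖ / 2 := add_le_add (h1.trans h2.le) h3.le
      _ = q * ‖c‖ := by ring
  -- (5) the Newton map is a `q`-contraction of `B̄(ω₀, ρ')` into itself
  set N : ℂ → ℂ := fun ω ↦ ω - F ω μ / c with hN
  have hNd : ∀ ω ∈ closedBall ω₀ ρ', HasDerivAt N (1 - deriv (fun z ↦ F z μ) ω / c) ω := by
    intro ω hω
    have hωb : ω ∈ ball ω₀ ρ₁ := hcb (hballsub ω hω (mem_closedBall_self hρ'0.le))
    have hF := (hFμ.differentiableAt (isOpen_ball.mem_nhds hωb)).hasDerivAt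
    exact (hasDerivAt_id ω).sub (hF.div_const c)
  have hNlip : ∀ x ∈ closedBall ω₀ ρ', ∀ y ∈ closedBall ω₀ ρ', ‖N x - N y‖ ≤ q * ‖x - y‖ := by
    intro x hx y hy
    refine (convex_closedBall ω₀ ρ').norm_image_sub_le_of_norm_deriv_le (fun z hz ↦ (hNd z hz).differentiableAt)
      (fun z hz ↦ ?_) hy hx
    rw [(hNd z hz).deriv]
    have h1 := hderμ z hz
    rw [show (1 : ℂ) - deriv (fun z ↦ F z μ) z / c = (c - deriv (fun z ↦ F z μ) z) / c by field_simp, norm_div,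
      div_le_iff₀ hcn, norm_sub_rev]
    exact h1
  have hF0μ : ‖F ω₀ μ‖ < ε := by
    have := hdiff ω₀ (mem_closedBall_self (by linarith))
    rwa [h0, sub_zero] at this
  have hmaps : MapsTo N (closedBall ω₀ ρ') (closedBall ω₀ ρ') := by
    intro ω hω
    rw [mem_closedBall, dist_eq_norm]
    have h1 := hNlip ω hω ω₀ (mem_closedBall_self hρ'0.le)
    have h2 : ‖N ω₀ - ω₀‖ = ‖F ω₀ μ‖ / ‖c‖ := by simp only [hN]; rw [sub_sub_cancel_left, norm_neg, norm_div]
    have h3 : ‖F ω₀ μ‖ / ‖c‖ ≤ (1 - q) * ρ' := by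
      rw [div_le_iff₀ hcn]
      have : ε ≤ (1 - q) * ρ' * ‖c‖ := by
        rw [hε]; nlinarith [hcn, hρ'0]
      linarith
    have hω' : ‖ω - ω₀‖ ≤ ρ' := by rwa [mem_closedBall, dist_eq_norm] at hω
    calc ‖N ω - ω₀‖ = ‖(N ω - N ω₀) + (N ω₀ - ω₀)‖ := by ring_nf
      _ ≤ ‖N ω - N ω₀‖ + ‖N ω₀ - ω₀‖ := norm_add_le _ _
      _ ≤ q * ‖ω - ω₀‖ + (1 - q) * ρ' := add_le_add h1 (h2 ▸ h3)
      _ ≤ q * ρ' + (1 - q) * ρ' := by gcongr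
      _ = ρ' := by ring
  -- (6) the fixed point
  obtain ⟨y, hy, hfix⟩ := exists_fixedPt_of_contraction hq0.le (by linarith) hmaps hNlip hρ'0.le
  refine ⟨y, hy, ?_, ?_⟩
  · have : y - F y μ / c = y := hfix
    have h1 : F y μ / c = 0 := by linear_combination -this
    rcases div_eq_zero_iff.1 h1 with h2 | h2
    · exact h2
    · exact absurd h2 hc
  · have key := norm_fixedPt_sub_le hq0.le hNlip (mem_closedBall_self hρ'0.le) hy hfix
    have hNω₀ : N ω₀ = ω₀ - F ω₀ μ / c := rfl
    have e1 : ‖N ω₀ - ω₀‖ = ‖F ω₀ μ / c‖ := by rw [hNω₀, sub_sub_cancel_left, norm_neg]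
    rw [hNω₀] at key
    rw [e1] at key
    have h1q : 0 < 1 - q := by linarith
    have hqθ : q ≤ θ * (1 - q) := by rw [hq]; nlinarith
    have hn : 0 ≤ ‖F ω₀ μ / c‖ := norm_nonneg _
    have := mul_le_mul_of_nonneg_right hqθ hn
    nlinarith

end Literature.Analysis.Complex
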